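import Literature.Barriers.CriticalPhenomena.PlaquetteWalkHoleRootOneRouteSigns
import Literature.Barriers.CriticalPhenomena.PlaquetteWalkHoleRootCutLawOver
import HarnessLib

/-!
# Barrier catalogue (SAWScalingLimit): CUTS ⇒ SIGNS AND FORCED ZEROS of the vertex observable at the far cell of a hole root

Leaf of `PlaquetteWalkHoleRootOneRouteSigns` (one route unwound ⇒ the sign of `Im VF(θ)`; both unwound ⇒ `VF(θ) = 0`) and
`PlaquetteWalkHoleRootCutLawOver` (the one-live-edge criterion for under-walks — cuts from the lower corner `(w.1, w.2)` of the root
edge, `ΩG.WE_eq_excursionWinding_of_under_cut` of its parent — and for over-walks — cuts from the upper corner `(w.1, w.2 + 1)`,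
`ΩG.WE_eq_excursionWinding_of_over_cut`). Composing them gives the programme's top-level schema, for a face list `Dl` with the hole
absent and the far cell present:

§1 ★★★★★ `im_vertexFunctional_printed_nonneg_of_under_cut` — a lattice cut from the LOWER corner of the root edge to beyond the domain
with no two live edges ⇒ `Im VF(θ) ≥ 0` on `[π/3, 2π/3]`; ★★★★★ `im_vertexFunctional_printed_nonpos_of_over_cut` — from the UPPER
corner ⇒ `Im VF(θ) ≤ 0`.
§2 ★★★★★ `vertexFunctional_printed_eq_zero_of_under_cut_over_cut` — THE FORCED ZERO: one such cut from each corner ⇒ `VF(θ) = 0` for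
every `θ ∈ [π/3, 2π/3]` (the Glazman–Manolescu vertex relation holds identically at that root although the domain has a hole).

Not in print; venture lane «pcv-sawmu», seat b-step0 gen 29 (FINDING-YB-KILL-FORCED-ZEROS §28).

References: A. Glazman, I. Manolescu, arXiv:1708.00395v3, §1 (eq. (1), Fig. 2), §2.1, §4.2, Lemma 2.1 [GlazmanManolescu2019];
A. Glazman, Electron. Commun. Probab. 20 (2015) no. 86, Lemma 3.1, proof pp. 6–7 [Glazman2015WeightedSAW]; R. Courant, H. Robbins,
*What is Mathematics?* (1941/1958), Ch. V Appendix §2 (the even–odd rule) [CourantRobbins1958].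
-/

noncomputable section

open Set Function Complex
open Literature.Topology.PlaneTopology

namespace Literature.Barriers.CriticalPhenomena.PlaquetteWalk

open Literature.Probability.RandomPlanarGeometry.SAW.YangBaxter
open Real Complex

open private rev_firstSide rev_isB2a from Literature.Probability.RandomPlanarGeometry.YangBaxterSAWGeneralDomain

variable {Dl : List Face} {w : Face}

/-! ## §1 One cut ⇒ the sign of `Im VF` -/

/-- ★★★★★ **A CUT FROM THE LOWER CORNER WITH NO TWO LIVE EDGES ⇒ `Im VF(θ) ≥ 0`.** Face list `Dl`, hole absent, far cell present; a
lattice cut `q 0 = (w.1, w.2), …, q K` ending beyond `dom Dl` (in one of the four axis directions), edges neither the hole's `W` side nor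
the root edge, no two of them live. Then `Im VF(θ) ≥ 0` for `θ ∈ [π/3, 2π/3]` (the under route carries no wound walk).
[cite: GlazmanManolescu2019, §1 eq. (1), Lemma 2.1 (statement, "in the form given in [Gl]")]
[cite: Glazman2015WeightedSAW, Lemma 3.1 (proof, pp. 6–7)] [cite: CourantRobbins1958, Ch. V Appendix §2 (the even–odd rule)] -/
theorem im_vertexFunctional_printed_nonneg_of_under_cut {θ : ℝ} (hθ : θ ∈ Set.Icc (π / 3) (2 * π / 3))
    (hf : farW w ∈ Dl) (hh : holeFaceW w ∉ dom Dl) {q : ℕ → ℤ × ℤ} {c : ℕ → Face} {s : ℕ → Side} {K : ℕ}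
    (hq0 : q 0 = w)
    (hseg : ∀ k, k < K → segment ℝ (toC (cornerPt (q k))) (toC (cornerPt (q (k + 1)))) = sideSeg (c k) (s k))
    (h1 : ∀ k, k < K → (c k).side (s k) ≠ (holeFaceW w).side .W) (h2 : ∀ k, k < K → (c k).side (s k) ≠ w.side .W)
    (hexit : (∀ f : Face, f ∈ dom Dl → f.1 < (q K).1) ∨ (∀ f : Face, f ∈ dom Dl → (q K).1 ≤ f.1) ∨
      (∀ f : Face, f ∈ dom Dl → (q K).2 ≤ f.2) ∨ (∀ f : Face, f ∈ dom Dl → f.2 < (q K).2))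
    (hdead : ∀ k k', k < k' → k' < K →
      (((c k).side (s k)).faces.1 ∉ dom Dl ∨ ((c k).side (s k)).faces.2 ∉ dom Dl) ∨
        (((c k').side (s k')).faces.1 ∉ dom Dl ∨ ((c k').side (s k')).faces.2 ∉ dom Dl)) :
    0 ≤ (vertexFunctional (printedWeights θ) tFiveEighths (ybCoeff θ) Dl (w.side .W) (farW w)).im :=
  have hr := rootedFace_farW (show farW w ∈ dom Dl from hf) hh
  im_vertexFunctional_printed_nonneg_of_under_unwound hθ hf hh hr fun ω h hS =>
    ΩG.WE_eq_excursionWinding_of_under_cut hh hq0 hseg h1 h2 hexit hdead ω hr h hS θ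

/-- ★★★★★ **A CUT FROM THE UPPER CORNER WITH NO TWO LIVE EDGES ⇒ `Im VF(θ) ≤ 0`** (cut `q 0 = (w.1, w.2 + 1), …, q K`; the over route
carries no wound walk). [cite: GlazmanManolescu2019, §1 eq. (1), §4.2 (lattice symmetries), Lemma 2.1]
[cite: Glazman2015WeightedSAW, Lemma 3.1 (proof, pp. 6–7)] [cite: CourantRobbins1958, Ch. V Appendix §2 (the even–odd rule)] -/
theorem im_vertexFunctional_printed_nonpos_of_over_cut {θ : ℝ} (hθ : θ ∈ Set.Icc (π / 3) (2 * π / 3))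
    (hf : farW w ∈ Dl) (hh : holeFaceW w ∉ dom Dl) {q : ℕ → ℤ × ℤ} {c : ℕ → Face} {s : ℕ → Side} {K : ℕ}
    (hq0 : q 0 = (w.1, w.2 + 1))
    (hseg : ∀ k, k < K → segment ℝ (toC (cornerPt (q k))) (toC (cornerPt (q (k + 1)))) = sideSeg (c k) (s k))
    (h1 : ∀ k, k < K → (c k).side (s k) ≠ (holeFaceW w).side .W) (h2 : ∀ k, k < K → (c k).side (s k) ≠ w.side .W)
    (hexit : (∀ f : Face, f ∈ dom Dl → f.1 < (q K).1) ∨ (∀ f : Face, f ∈ dom Dl → (q K).1 ≤ f.1) ∨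
      (∀ f : Face, f ∈ dom Dl → (q K).2 ≤ f.2) ∨ (∀ f : Face, f ∈ dom Dl → f.2 < (q K).2))
    (hdead : ∀ k k', k < k' → k' < K →
      (((c k).side (s k)).faces.1 ∉ dom Dl ∨ ((c k).side (s k)).faces.2 ∉ dom Dl) ∨
        (((c k').side (s k')).faces.1 ∉ dom Dl ∨ ((c k').side (s k')).faces.2 ∉ dom Dl)) :
    (vertexFunctional (printedWeights θ) tFiveEighths (ybCoeff θ) Dl (w.side .W) (farW w)).im ≤ 0 :=
  have hr := rootedFace_farW (show farW w ∈ dom Dl from hf) hh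
  im_vertexFunctional_printed_nonpos_of_over_unwound hθ hf hh hr fun ω h hN =>
    ΩG.WE_eq_excursionWinding_of_over_cut hh hq0 hseg h1 h2 hexit hdead ω hr h hN θ

/-! ## §2 Two cuts ⇒ a forced zero -/

/-- ★★★★★ **THE FORCED ZERO.** Face list `Dl`, hole absent, far cell present; a cut from the LOWER corner of the root edge and a cut from
the UPPER corner, each ending beyond the domain, with admissible edges and no two live edges. Then the vertex observable at the far
cell VANISHES at every `θ ∈ [π/3, 2π/3]`: neither route carries a wound walk, so both wound masses are zero.
[cite: GlazmanManolescu2019, §1 eq. (1) (the vertex relation), Lemma 2.1, §4.2 (lattice symmetries)]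
[cite: Glazman2015WeightedSAW, Lemma 3.1 (proof, pp. 6–7)] [cite: CourantRobbins1958, Ch. V Appendix §2 (the even–odd rule)] -/
theorem vertexFunctional_printed_eq_zero_of_under_cut_over_cut {θ : ℝ} (hθ : θ ∈ Set.Icc (π / 3) (2 * π / 3))
    (hf : farW w ∈ Dl) (hh : holeFaceW w ∉ dom Dl)
    {q : ℕ → ℤ × ℤ} {c : ℕ → Face} {s : ℕ → Side} {K : ℕ} (hq0 : q 0 = w)
    (hseg : ∀ k, k < K → segment ℝ (toC (cornerPt (q k))) (toC (cornerPt (q (k + 1)))) = sideSeg (c k) (s k))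
    (h1 : ∀ k, k < K → (c k).side (s k) ≠ (holeFaceW w).side .W) (h2 : ∀ k, k < K → (c k).side (s k) ≠ w.side .W)
    (hexit : (∀ f : Face, f ∈ dom Dl → f.1 < (q K).1) ∨ (∀ f : Face, f ∈ dom Dl → (q K).1 ≤ f.1) ∨
      (∀ f : Face, f ∈ dom Dl → (q K).2 ≤ f.2) ∨ (∀ f : Face, f ∈ dom Dl → f.2 < (q K).2))
    (hdead : ∀ k k', k < k' → k' < K →
      (((c k).side (s k)).faces.1 ∉ dom Dl ∨ ((c k).side (s k)).faces.2 ∉ dom Dl) ∨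
        (((c k').side (s k')).faces.1 ∉ dom Dl ∨ ((c k').side (s k')).faces.2 ∉ dom Dl))
    {q' : ℕ → ℤ × ℤ} {c' : ℕ → Face} {s' : ℕ → Side} {K' : ℕ} (hq0' : q' 0 = (w.1, w.2 + 1))
    (hseg' : ∀ k, k < K' → segment ℝ (toC (cornerPt (q' k))) (toC (cornerPt (q' (k + 1)))) = sideSeg (c' k) (s' k))
    (h1' : ∀ k, k < K' → (c' k).side (s' k) ≠ (holeFaceW w).side .W) (h2' : ∀ k, k < K' → (c' k).side (s' k) ≠ w.side .W)
    (hexit' : (∀ f : Face, f ∈ dom Dl → f.1 < (q' K').1) ∨ (∀ f : Face, f ∈ dom Dl → (q' K').1 ≤ f.1) ∨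
      (∀ f : Face, f ∈ dom Dl → (q' K').2 ≤ f.2) ∨ (∀ f : Face, f ∈ dom Dl → f.2 < (q' K').2))
    (hdead' : ∀ k k', k < k' → k' < K' →
      (((c' k).side (s' k)).faces.1 ∉ dom Dl ∨ ((c' k).side (s' k)).faces.2 ∉ dom Dl) ∨
        (((c' k').side (s' k')).faces.1 ∉ dom Dl ∨ ((c' k').side (s' k')).faces.2 ∉ dom Dl)) :
    vertexFunctional (printedWeights θ) tFiveEighths (ybCoeff θ) Dl (w.side .W) (farW w) = 0 := by
  refine vertexFunctional_printed_eq_zero_of_both_unwound hθ hf hh fun hr ω h => ?_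
  by_contra hW
  -- a wound walk at the far cell entered it over or under the hole (never from the west)
  have hNS : ω.2.firstSideG = .N ∨ ω.2.firstSideG = .S := by
    rcases ω.AJ_ne_zero_or_rev_of_wound hr h θ hW with hA | hA
    · exact ΩG.firstSide_eq_N_or_S_of_wound hh ω hr h hA
    · have h' := ω.rev_isB2a hr h
      have := ΩG.firstSide_eq_N_or_S_of_wound hh (ω.rev hr) hr h' hA
      rwa [ω.rev_firstSide hr h] at this
  rcases hNS with hN | hS
  · exact hW (ΩG.WE_eq_excursionWinding_of_over_cut hh hq0' hseg' h1' h2' hexit' hdead' ω hr h hN θ)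
  · exact hW (ΩG.WE_eq_excursionWinding_of_under_cut hh hq0 hseg h1 h2 hexit hdead ω hr h hS θ)

end Literature.Barriers.CriticalPhenomena.PlaquetteWalk
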